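/-
Origin: expansion seat `prover-pub-hodgecm-mc-carch-1-g37-0`, handover #CA71 2026-08-21T03:20Z md5 fd85d22c652d (404 l.; NEW additive leaf; imports #CA70 Model.ArchKTypeOfCentralWeightPin (this kit) + Model.ArchKTypeOfDist34 (#CA66, RUN 69); ns HodgeCM.Model.ArchSideTerm; 14 theorems 0 defs; NAMES for audit: HodgeCM.Model.ArchSideTerm.lineCharV_two_center_mul_lineC · HodgeCM.Model.ArchSideTerm.w_mul_lineCharV_two_eq_torusScalar_of_eq_blockFamilyOfAt · HodgeCM.Model.ArchSideTerm.w_mul_lineCharV_three_eq_torusScalar_of_eq_blockFamilyOfAt) (`HOME/mc/pub-hodgecm-mc-carch-1/stage71/HodgeCM/Model/ArchKTypeOfCentralWeightPin34.lean`, md5 fd85d22c652d, 404 lines);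
landed by the gen-30 packager (p-g30) in gate run 71 as `HodgeCM/Model/ArchKTypeOfCentralWeightPin34.lean` (verbatim).
-/
/-
Copyright (c) 2026. Released under Apache 2.0 license as described in the file LICENSE.
Cell pub-hodgecm, MODEL layer (construction prover mc-carch-1, gen 37), row-9 (J-Liu-Θ) junction: (CF_k) ∕ (Hw_k′) DISCHARGED for the honest
harmonic datum of slots 2 and 3 (conjugated plane) (sinst-1-g11 SEAM NOTE 2026-08-21 (Hw_k); binder-1 #R125 pin currency `hemb eR eS hχ a hω hdef`).
-/
import Summits.HodgeConjecture.HodgeCM.Model.ArchKTypeOfCentralWeightPin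
import Summits.HodgeConjecture.HodgeCM.Model.ArchKTypeOfDist34

/-!
# `w_k · s_k(centre) = torusScalar_k` AT THE HONEST HARMONIC DATUM (slots 2, 3 — the conjugated plane)

`Model/ArchKTypeOfCentralWeight` reduces sinst-1's archimedean identity (Hw_k′) `w t · lineCharV_k (u_t · 1_V) = torusScalar_k (u_t)` of an
archimedean input `A : ArchLineInput V (lineRepOf … k)` to (CF_k): the archimedean CENTRE in the `U(V)`-slot of the twisted line kernel fixes the
pinned vector.  Here (CF_k) is PROVED, `k = 2, 3` (the lines `⟨a₂⟩, ⟨a₃⟩` of the conjugated plane; the slot-0/1 twin is `Model/ArchKTypeOfCentralWeightPin`), for the honest harmonic slot family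
`Φ_∞,k(ℓ) := blockFamilyOfAt … eR eS (degOnePDual Empty) (binvPi 1) ℓ` (#CA13) from EXACTLY binder-1's pin hypotheses (#R126/#R127 `pinDatumTwo/Three`; #CA66's `hω`/`hdef`/`hχ`, no `h₁W`):

* away from `w(ι₁)`: the away factor `centerAway V t` (trivial at `w(ι₁)`) acts trivially under `c_k • ω_∞,k` by (c5) — #CA61's `hω` (exponent table)
  and `hdef` (definite type of the line scalar) through #CA20's place induction `smul_apply_eq_self_of_places`
  (`archScalar_kG_smul_centerAway_blockFamilyOfAt`);
* at `w(ι₁)`: the `ι₁`-section factor at the CENTRAL `z_t · 1 ∈ K` acts through `lineOmega_k` by `τ₁^∨(z_t · 1) = id` — carch's #CA66 `harm_lineOmega_two/threeG`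
  (`hemb eR eS hχ`) + `weightOf_dual_blockK_centralK` (`lineScalar_k_smul_centerK_blockFamilyOfAt`);
* assembled: **`lineCharV_k_smul_cmArchCenter_blockFamilyOfAt`** ((CF_k) on `𝒮((L⁺ ⊗ ℝ)³)`), **`lineCharV_k_smul_cmPairRep_center_testFun`**
  ((CF_k) on every `φ_N`, the hypothesis `hfix` of `w_mul_lineCharV_k_eq_torusScalar`), and
  **`w_mul_lineCharV_k_eq_torusScalar_of_eq_blockFamilyOfAt`**: (Hw_k′) for ANY four `η`'s / conjugated-plane splittings and ANY
  `A : ArchLineInput V (lineRepOf … k)` with `A.Φinf = Φ_∞,k(ℓ₀)`.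

Reading for the consumers: at the pin of record (`archSideOfT'`, `η₂ := etaT₂ V c.D η ν'`, `η₃ := etaT₃ V c.D η ν'`) `lineCharV_two = ν'⁻¹ · η(·,1) · χ′₀(·,1)` and
`lineCharV_three = ν'` (`etaT₂/etaT₃_apply_mk_one`) are the twists the slot-2/3 dictionary records carry (sinst-1's #1256/#1264 pattern).
Nothing is cited and nothing is minted: kernel lemmas over installed carch modules; 0 records, 0 `def … : Prop`.
-/

set_option autoImplicit false

noncomputable section

open NumberField NumberField.InfinitePlace NumberField.mixedEmbedding IsDedekindDomain
open scoped Matrix TensorProduct Classical SchwartzMap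
open MulAction
open Literature.Geometry.ComplexHyperbolic.BallModel (U21 x₀ stabilizerEquivK21 blockK blockU bmat mat_blockU)
open Literature.NumberTheory.Automorphic.U21 (K21 matA sclD)
open Literature.AlgebraicGeometry.ShimuraVarieties Literature.AlgebraicGeometry.ShimuraVarieties.BallForms
open Literature.NumberTheory.Automorphic Literature.NumberTheory.Automorphic.UnitaryGroup Literature.NumberTheory.Weil1964
open Literature.RepresentationTheory.KonnoKonno2007 Literature.RepresentationTheory.KonnoKonno2007.RealDualPair
open Literature.NumberTheory.GelbartRogawski1991 Literature.NumberTheory.GelbartRogawski1991.UnitaryDualPair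
open Literature.Analysis.SegalBargmann
open HodgeCM.Adelic HodgeCM.PerL34 HodgeCM.Model.HypCensus HodgeCM.Model.SupplyInstance

namespace HodgeCM.Model.ArchSideTerm

/-! #### § 3e. (CF₂), (CF₃) for the honest harmonic datum of the conjugated plane, from `hemb eR eS hχ a hω hdef` (#CA66 currency) -/

section Honest34

variable {L : CMField} {ι₁ : L →+* ℂ} (V : HermSpace3 L ι₁) (c : SeesawCtx L)
variable
  (hGR : (cmSplittingDatum (L : Type) finProdFinEquiv (frameD V) (frameD_real V) (frameD_ne V) (dW c.D) (dW_real c.D)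
    (dW_ne c.D)).CompatibleSplitting)
  (hGR₂ : (cmSplittingDatum (L : Type) (e₁) (frameD V) (frameD_real V) (frameD_ne V) (lineVec (L : Type) (dW' c.D 0))
    (fun _ => dW'_real c.D 0) (fun _ => dW'_ne c.D 0)).CompatibleSplitting)
  (hGR₃ : (cmSplittingDatum (L : Type) (e₁) (frameD V) (frameD_real V) (frameD_ne V) (lineVec (L : Type) (dW' c.D 1))
    (fun _ => dW'_real c.D 1) (fun _ => dW'_ne c.D 1)).CompatibleSplitting)
  (η₂ η₃ : CMAdelic (L : Type) (frameD V) × CMAdelicOne (L : Type) →* ℂˣ)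
  (hemb : (InfinitePlace.mk ι₁).embedding = ι₁)

/-- the line-2 scalar on archimedean elements (#CA44 `archScalar_twoG`) is `lineCharV_two ∘ archToAdelic`. -/
theorem archScalar_twoG_eq_lineCharV
    (x : UnitaryGroup.arch (↥(maximalRealSubfield L)) L (IsCMField.complexConj L) 3 (Matrix.diagonal (frameD V))) :
    archScalar_twoG V c.D hGR hGR₂ hGR₃ η₂ x =
      lineCharV_two V c.D hGR hGR₂ hGR₃ η₂
        (UnitaryGroup.archToAdelic (↥(maximalRealSubfield L)) L (IsCMField.complexConj L) 3 (Matrix.diagonal (frameD V)) x) := rfl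

/-- the line-3 scalar on archimedean elements (#CA44 `archScalar_threeG`) is `lineCharV_three ∘ archToAdelic`. -/
theorem archScalar_threeG_eq_lineCharV
    (x : UnitaryGroup.arch (↥(maximalRealSubfield L)) L (IsCMField.complexConj L) 3 (Matrix.diagonal (frameD V))) :
    archScalar_threeG V c.D hGR hGR₂ hGR₃ η₃ x =
      lineCharV_three V c.D hGR hGR₂ hGR₃ η₃
        (UnitaryGroup.archToAdelic (↥(maximalRealSubfield L)) L (IsCMField.complexConj L) 3 (Matrix.diagonal (frameD V)) x) := rfl

/-! ##### slot 2 -/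

section Two

variable
  (eR : PosIdx (cmXW (L : Type) (frameD V) (lineVec (L : Type) (dW' c.D 0)) (fun _ => dW'_real c.D 0) ι₁ (HypCensus.cmPlace (L : Type) ι₁)) ≃ Unit)
  (eS : NegIdx (cmXW (L : Type) (frameD V) (lineVec (L : Type) (dW' c.D 0)) (fun _ => dW'_real c.D 0) ι₁ (HypCensus.cmPlace (L : Type) ι₁)) ≃ Empty)
  (hχ : ∀ u : stabilizer U21 x₀,
    ((lineScalar_two V c.D hGR hGR₂ hGR₃ η₂ (u : U21) : ℂˣ) : ℂ) *
        ((matA (stabilizerEquivK21.symm u)).det ^ (lineVacExponentsTwo V c hGR₂ eR eS).eP *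
          sclD (stabilizerEquivK21.symm u) ^ (lineVacExponentsTwo V c hGR₂ eR eS).eQ) =
      star (sclD (stabilizerEquivK21.symm u)))
  (a : {v : InfinitePlace ↥(maximalRealSubfield L) // v.IsReal} → ℤ)
  (hω : ∀ b : {v : InfinitePlace ↥(maximalRealSubfield L) // v.IsReal}, b ≠ HypCensus.cmPlace (L : Type) ι₁ →
    ∀ (u : UnitaryGroup.archLocal (L : Type) 3 (Matrix.diagonal (frameD V)) (cmPlaceOver (L : Type) b)) (ℓ : Module.Dual ℂ (Fin 2 → ℂ)),
      cmArchWeilRep (L : Type) e₁ (frameD V) (frameD_real V) (frameD_ne V) (lineVec (L : Type) (dW' c.D 0)) (fun _ => dW'_real c.D 0)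
          (fun _ => dW'_ne c.D 0) hGR₂
          (UnitaryGroup.archSingle (↥(maximalRealSubfield L)) L (IsCMField.complexConj L) 3 (Matrix.diagonal (frameD V))
            (IsCMField.complexConj_ne_one L) (NumberField.complexConj_smul_infinitePlace (L : Type)) (cmPlaceOver (L : Type) b) u, 1)
          (blockFamilyOfAt (L : Type) e₁ (frameD V) (frameD_real V) (frameD_ne V) (lineVec (L : Type) (dW' c.D 0)) (fun _ => dW'_real c.D 0)
            (fun _ => dW'_ne c.D 0) ι₁ (blockPosEquiv V) (blockNegEquiv V) eR eS (degOnePDual Empty) (binvPi 1) ℓ) =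
        (((u : UnitaryGroup.archLocal (L : Type) 3 (Matrix.diagonal (frameD V)) (cmPlaceOver (L : Type) b)) : GL (Fin 3) ℂ) :
            Matrix (Fin 3) (Fin 3) ℂ).det ^ a b •
          blockFamilyOfAt (L : Type) e₁ (frameD V) (frameD_real V) (frameD_ne V) (lineVec (L : Type) (dW' c.D 0)) (fun _ => dW'_real c.D 0)
            (fun _ => dW'_ne c.D 0) ι₁ (blockPosEquiv V) (blockNegEquiv V) eR eS (degOnePDual Empty) (binvPi 1) ℓ)
  (hdef : ∀ b : {v : InfinitePlace ↥(maximalRealSubfield L) // v.IsReal}, b ≠ HypCensus.cmPlace (L : Type) ι₁ →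
    ∀ u : UnitaryGroup.archLocal (L : Type) 3 (Matrix.diagonal (frameD V)) (cmPlaceOver (L : Type) b),
      ((archScalar_twoG V c.D hGR hGR₂ hGR₃ η₂
          (UnitaryGroup.archSingle (↥(maximalRealSubfield L)) L (IsCMField.complexConj L) 3 (Matrix.diagonal (frameD V))
            (IsCMField.complexConj_ne_one L) (NumberField.complexConj_smul_infinitePlace (L : Type)) (cmPlaceOver (L : Type) b) u) : ℂˣ) : ℂ) *
        (((u : UnitaryGroup.archLocal (L : Type) 3 (Matrix.diagonal (frameD V)) (cmPlaceOver (L : Type) b)) : GL (Fin 3) ℂ) :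
            Matrix (Fin 3) (Fin 3) ℂ).det ^ a b = 1)

include hω hdef in
/-- the AWAY factor of the centre fixes every member of the line-2 slot family under `c₂ • ω_∞,2` ((c5), #CA20's place induction). -/
theorem archScalar_twoG_smul_centerAway_blockFamilyOfAt
    (t : ↥(Literature.NumberTheory.Automorphic.relNormOneInfUnits (↥(maximalRealSubfield L)) L)) (ℓ : Module.Dual ℂ (Fin 2 → ℂ)) :
    ((archScalar_twoG V c.D hGR hGR₂ hGR₃ η₂ (centerAway V t) : ℂˣ) : ℂ) •
        cmArchWeilRep (L : Type) e₁ (frameD V) (frameD_real V) (frameD_ne V) (lineVec (L : Type) (dW' c.D 0)) (fun _ => dW'_real c.D 0)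
          (fun _ => dW'_ne c.D 0) hGR₂ (centerAway V t, 1)
          (blockFamilyOfAt (L : Type) e₁ (frameD V) (frameD_real V) (frameD_ne V) (lineVec (L : Type) (dW' c.D 0)) (fun _ => dW'_real c.D 0)
            (fun _ => dW'_ne c.D 0) ι₁ (blockPosEquiv V) (blockNegEquiv V) eR eS (degOnePDual Empty) (binvPi 1) ℓ) =
      blockFamilyOfAt (L : Type) e₁ (frameD V) (frameD_real V) (frameD_ne V) (lineVec (L : Type) (dW' c.D 0)) (fun _ => dW'_real c.D 0)
        (fun _ => dW'_ne c.D 0) ι₁ (blockPosEquiv V) (blockNegEquiv V) eR eS (degOnePDual Empty) (binvPi 1) ℓ := by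
  have h := smul_apply_eq_self_of_places (L : Type) (Matrix.diagonal (frameD V))
    ((cmArchWeilRep (L : Type) e₁ (frameD V) (frameD_real V) (frameD_ne V) (lineVec (L : Type) (dW' c.D 0)) (fun _ => dW'_real c.D 0)
      (fun _ => dW'_ne c.D 0) hGR₂).comp (MonoidHom.inl _ _))
    (archScalar_twoG V c.D hGR hGR₂ hGR₃ η₂)
    (blockFamilyOfAt (L : Type) e₁ (frameD V) (frameD_real V) (frameD_ne V) (lineVec (L : Type) (dW' c.D 0)) (fun _ => dW'_real c.D 0)
      (fun _ => dW'_ne c.D 0) ι₁ (blockPosEquiv V) (blockNegEquiv V) eR eS (degOnePDual Empty) (binvPi 1) ℓ)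
    (UnitaryGroup.cmPlace (L : Type) ι₁) (fun b hb u => by
      rw [MonoidHom.comp_apply, MonoidHom.inl_apply, hω b (ne_cmPlace_of_cmPlaceOver_ne hb) u ℓ, smul_smul,
        hdef b (ne_cmPlace_of_cmPlaceOver_ne hb) u, one_smul])
    (centerAway V t) (archAt_centerAway V t)
  rw [MonoidHom.comp_apply, MonoidHom.inl_apply] at h
  exact h

include hemb hχ in
/-- the `ι₁`-SECTION factor of the centre fixes every member of the line-2 slot family under `c₂ • ω_∞,2` (`harm` at the CENTRAL element
`z_t · 1 ∈ K`, `τ₁^∨(z · 1) = id`). -/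
theorem lineScalar_two_smul_centerK_blockFamilyOfAt
    (t : ↥(Literature.NumberTheory.Automorphic.relNormOneInfUnits (↥(maximalRealSubfield L)) L)) (ℓ : Module.Dual ℂ (Fin 2 → ℂ)) :
    ((lineScalar_two V c.D hGR hGR₂ hGR₃ η₂ ((centerK (L : Type) ι₁ t : stabilizer U21 x₀) : U21) : ℂˣ) : ℂ) •
        cmArchWeilRep (L : Type) e₁ (frameD V) (frameD_real V) (frameD_ne V) (lineVec (L : Type) (dW' c.D 0)) (fun _ => dW'_real c.D 0)
          (fun _ => dW'_ne c.D 0) hGR₂ (archSectionFrameOf V ((centerK (L : Type) ι₁ t : stabilizer U21 x₀) : U21), 1)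
          (blockFamilyOfAt (L : Type) e₁ (frameD V) (frameD_real V) (frameD_ne V) (lineVec (L : Type) (dW' c.D 0)) (fun _ => dW'_real c.D 0)
            (fun _ => dW'_ne c.D 0) ι₁ (blockPosEquiv V) (blockNegEquiv V) eR eS (degOnePDual Empty) (binvPi 1) ℓ) =
      blockFamilyOfAt (L : Type) e₁ (frameD V) (frameD_real V) (frameD_ne V) (lineVec (L : Type) (dW' c.D 0)) (fun _ => dW'_real c.D 0)
        (fun _ => dW'_ne c.D 0) ι₁ (blockPosEquiv V) (blockNegEquiv V) eR eS (degOnePDual Empty) (binvPi 1) ℓ := by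
  have hv := harm_lineOmega_twoG V c hGR hGR₂ hGR₃ η₂ (binvPi 1) hemb eR eS hχ (centerK (L : Type) ι₁ t) ℓ
  rw [centerK_def, weightOf_dual_blockK_centralK, ← centerK_def, lineOmega_two, Representation.smulPull_apply] at hv
  exact hv

include hemb hχ hω hdef in
/-- **(CF₂) on the slot family**: the archimedean CENTRE `t · 1_V` in the `U(V)`-slot of line 2 fixes every member `Φ_∞,2(ℓ)`:
`lineCharV_2(u_t · 1_V) • ω_∞,2(t · 1₃, 1) Φ_∞,2(ℓ) = Φ_∞,2(ℓ)`. -/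
theorem lineCharV_two_smul_cmArchCenter_blockFamilyOfAt
    (t : ↥(Literature.NumberTheory.Automorphic.relNormOneInfUnits (↥(maximalRealSubfield L)) L)) (ℓ : Module.Dual ℂ (Fin 2 → ℂ)) :
    ((lineCharV_two V c.D hGR hGR₂ hGR₃ η₂ (CMCenter (L : Type) (frameD V) ((UnitaryGroup.cmAdelicOneEquivRelNormOne (L : Type)).symm
        (Literature.NumberTheory.Automorphic.relNormOneInfToIdeles (↥(maximalRealSubfield L)) L t))) : ℂˣ) : ℂ) •
        cmArchWeilRep (L : Type) e₁ (frameD V) (frameD_real V) (frameD_ne V) (lineVec (L : Type) (dW' c.D 0)) (fun _ => dW'_real c.D 0)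
          (fun _ => dW'_ne c.D 0) hGR₂ (cmArchCenter (L : Type) 3 (Matrix.diagonal (frameD V)) t, 1)
          (blockFamilyOfAt (L : Type) e₁ (frameD V) (frameD_real V) (frameD_ne V) (lineVec (L : Type) (dW' c.D 0)) (fun _ => dW'_real c.D 0)
            (fun _ => dW'_ne c.D 0) ι₁ (blockPosEquiv V) (blockNegEquiv V) eR eS (degOnePDual Empty) (binvPi 1) ℓ) =
      blockFamilyOfAt (L : Type) e₁ (frameD V) (frameD_real V) (frameD_ne V) (lineVec (L : Type) (dW' c.D 0)) (fun _ => dW'_real c.D 0)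
        (fun _ => dW'_ne c.D 0) ι₁ (blockPosEquiv V) (blockNegEquiv V) eR eS (degOnePDual Empty) (binvPi 1) ℓ := by
  rw [← archToAdelic_cmArchCenter_frameD, ← archScalar_twoG_eq_lineCharV, cmArchCenter_eq_archSectionFrameOf_mul_centerAway V t,
    map_mul, Units.val_mul,
    show ((archSectionFrameOf V ((centerK (L : Type) ι₁ t : stabilizer U21 x₀) : U21) * centerAway V t,
        (1 : UnitaryGroup.arch (↥(maximalRealSubfield L)) L (IsCMField.complexConj L) 1 (Matrix.diagonal (lineVec (L : Type) (dW' c.D 0))))) :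
        UnitaryGroup.arch (↥(maximalRealSubfield L)) L (IsCMField.complexConj L) 3 (Matrix.diagonal (frameD V)) ×
          UnitaryGroup.arch (↥(maximalRealSubfield L)) L (IsCMField.complexConj L) 1 (Matrix.diagonal (lineVec (L : Type) (dW' c.D 0)))) =
      (archSectionFrameOf V ((centerK (L : Type) ι₁ t : stabilizer U21 x₀) : U21), 1) * (centerAway V t, 1) by rw [Prod.mk_mul_mk, mul_one],
    map_mul, Module.End.mul_apply, mul_smul, ← map_smul, archScalar_twoG_smul_centerAway_blockFamilyOfAt V c hGR hGR₂ hGR₃ η₂ eR eS a hω hdef]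
  exact lineScalar_two_smul_centerK_blockFamilyOfAt V c hGR hGR₂ hGR₃ η₂ hemb eR eS hχ t ℓ

include hemb hχ hω hdef in
/-- **(CF₂) on thin-coset test functions**: `lineCharV_2(u_t·1_V) • ω₂(u_t·1_V, 1) φ_N(Φ_∞,2(ℓ)) = φ_N(Φ_∞,2(ℓ))` at every base point and level
(the hypothesis `hfix` of `w_mul_lineCharV_two_eq_torusScalar`, DISCHARGED for the harmonic family). -/
theorem lineCharV_two_smul_cmPairRep_center_testFun
    (t : ↥(Literature.NumberTheory.Automorphic.relNormOneInfUnits (↥(maximalRealSubfield L)) L)) (ℓ : Module.Dual ℂ (Fin 2 → ℂ))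
    (x : Fin 3 → ↥(maximalRealSubfield L)) (N : ℕ) :
    ((lineCharV_two V c.D hGR hGR₂ hGR₃ η₂ (CMCenter (L : Type) (frameD V) ((UnitaryGroup.cmAdelicOneEquivRelNormOne (L : Type)).symm
        (Literature.NumberTheory.Automorphic.relNormOneInfToIdeles (↥(maximalRealSubfield L)) L t))) : ℂˣ) : ℂ) •
        cmPairRep (L : Type) e₁ (frameD V) (frameD_real V) (frameD_ne V) (lineVec (L : Type) (dW' c.D 0)) (fun _ => dW'_real c.D 0)
          (fun _ => dW'_ne c.D 0) hGR₂
          (CMCenter (L : Type) (frameD V) ((UnitaryGroup.cmAdelicOneEquivRelNormOne (L : Type)).symm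
            (Literature.NumberTheory.Automorphic.relNormOneInfToIdeles (↥(maximalRealSubfield L)) L t)), 1)
          (SupplyInstance.testFun (↥(maximalRealSubfield L)) (Fin 3)
            (blockFamilyOfAt (L : Type) e₁ (frameD V) (frameD_real V) (frameD_ne V) (lineVec (L : Type) (dW' c.D 0)) (fun _ => dW'_real c.D 0)
              (fun _ => dW'_ne c.D 0) ι₁ (blockPosEquiv V) (blockNegEquiv V) eR eS (degOnePDual Empty) (binvPi 1) ℓ) x N) =
      SupplyInstance.testFun (↥(maximalRealSubfield L)) (Fin 3)
        (blockFamilyOfAt (L : Type) e₁ (frameD V) (frameD_real V) (frameD_ne V) (lineVec (L : Type) (dW' c.D 0)) (fun _ => dW'_real c.D 0)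
          (fun _ => dW'_ne c.D 0) ι₁ (blockPosEquiv V) (blockNegEquiv V) eR eS (degOnePDual Empty) (binvPi 1) ℓ) x N := by
  rw [cmPairRep_cmCenter_inf_one_testFun, ← testFun_smul,
    lineCharV_two_smul_cmArchCenter_blockFamilyOfAt V c hGR hGR₂ hGR₃ η₂ hemb eR eS hχ a hω hdef]

include hemb hχ hω hdef in
/-- **(Hw₂′) DISCHARGED for an archimedean input pinned on the harmonic family**: for ANY four `η`'s, ANY conjugated-plane splittings and
ANY `A : ArchLineInput V (lineRepOf … 2)` with `A.Φinf = Φ_∞,2(ℓ₀)`:  `A.w t · lineCharV_2 (u_t · 1_V) = torusScalar_2 (u_t)` for every `t`.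
At the pin of record `η₂ := etaT₂ V c.D η ν'`. -/
theorem w_mul_lineCharV_two_eq_torusScalar_of_eq_blockFamilyOfAt
    (hGR₀ : (cmSplittingDatum (L : Type) (e₁) (frameD V) (frameD_real V) (frameD_ne V) (lineVec (L : Type) (dW c.D 0))
      (fun _ => dW_real c.D 0) (fun _ => dW_ne c.D 0)).CompatibleSplitting)
    (hGR₁ : (cmSplittingDatum (L : Type) (e₁) (frameD V) (frameD_real V) (frameD_ne V) (lineVec (L : Type) (dW c.D 1))
      (fun _ => dW_real c.D 1) (fun _ => dW_ne c.D 1)).CompatibleSplitting)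
    (η₀ η₁ : CMAdelic (L : Type) (frameD V) × CMAdelicOne (L : Type) →* ℂˣ)
    (A : ArchLineInput V (lineRepOf V c.D hGR hGR₀ hGR₁ hGR₂ hGR₃ η₀ η₁ η₂ η₃ 2)) {ℓ₀ : Module.Dual ℂ (Fin 2 → ℂ)}
    (hΦ : A.Φinf = blockFamilyOfAt (L : Type) e₁ (frameD V) (frameD_real V) (frameD_ne V) (lineVec (L : Type) (dW' c.D 0)) (fun _ => dW'_real c.D 0)
      (fun _ => dW'_ne c.D 0) ι₁ (blockPosEquiv V) (blockNegEquiv V) eR eS (degOnePDual Empty) (binvPi 1) ℓ₀)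
    (t : ↥(Literature.NumberTheory.Automorphic.relNormOneInfUnits (↥(maximalRealSubfield L)) L)) :
    A.w t * ((lineCharV_two V c.D hGR hGR₂ hGR₃ η₂ (CMCenter (L : Type) (frameD V)
          ((UnitaryGroup.cmAdelicOneEquivRelNormOne (L : Type)).symm
            (Literature.NumberTheory.Automorphic.relNormOneInfToIdeles (↥(maximalRealSubfield L)) L t))) : ℂˣ) : ℂ) =
      ((torusScalar_twoG V c.D hGR hGR₂ hGR₃ η₂ ((UnitaryGroup.cmAdelicOneEquivRelNormOne (L : Type)).symm
            (Literature.NumberTheory.Automorphic.relNormOneInfToIdeles (↥(maximalRealSubfield L)) L t)) : ℂˣ) : ℂ) :=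
  by
  have hfix := lineCharV_two_smul_cmPairRep_center_testFun V c hGR hGR₂ hGR₃ η₂ hemb eR eS hχ a hω hdef t ℓ₀ A.x₀ 1
  rw [← hΦ] at hfix
  exact w_mul_lineCharV_two_eq_torusScalar V c.D hGR hGR₀ hGR₁ hGR₂ hGR₃ η₀ η₁ η₂ η₃ A t one_ne_zero hfix

include hemb hχ hω hdef in
/-- **(CC₂) the character identity of the centre**: `lineCharV_2(u_t · 1_V) · c₂(t) = 1` with theta-3's centre eigenvalue
`c₂ = lineC … hGR₂ = lineCenterChar · archPlaceChar_(w(ι₁))` (#CA60 `cmArchWeilRep_center_blockFamilyOfAt`): on the archimedean centre the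
`V`-twist of line 2 is the INVERSE of the central character of the untwisted `ω_∞,2` on the harmonic vector — the one sentence behind BOTH the
index-side `hμ` (theta-3's `centralTypeOf` ∕ #S19 `centerCharInf`) and the automorphy-side `hw` ((Hw₂′)). -/
theorem lineCharV_two_center_mul_lineC
    (t : ↥(Literature.NumberTheory.Automorphic.relNormOneInfUnits (↥(maximalRealSubfield L)) L)) :
    ((lineCharV_two V c.D hGR hGR₂ hGR₃ η₂ (CMCenter (L : Type) (frameD V) ((UnitaryGroup.cmAdelicOneEquivRelNormOne (L : Type)).symm
        (Literature.NumberTheory.Automorphic.relNormOneInfToIdeles (↥(maximalRealSubfield L)) L t))) : ℂˣ) : ℂ) *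
      lineC V (dW' c.D 0) (dW'_real c.D 0) (dW'_ne c.D 0) hGR₂ t = 1 := by
  have h := lineCharV_two_smul_cmArchCenter_blockFamilyOfAt V c hGR hGR₂ hGR₃ η₂ hemb eR eS hχ a hω hdef t
    (dotProductEquiv ℂ (Fin 2) (Pi.single 0 1))
  rw [cmArchWeilRep_center_blockFamilyOfAt, smul_smul] at h
  exact smul_cancel_of_ne_zero (blockFamilyOfAt_degOnePDual_binvPi_one_ne_zero Empty (L : Type) e₁ (frameD V) (frameD_real V) (frameD_ne V)
    (lineVec (L : Type) (dW' c.D 0)) (fun _ => dW'_real c.D 0) (fun _ => dW'_ne c.D 0) ι₁ (blockPosEquiv V) (blockNegEquiv V) eR eS)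
    (h.trans (one_smul ℂ _).symm)

end Two


/-! ##### slot 3 -/

section Three

variable
  (eR : PosIdx (cmXW (L : Type) (frameD V) (lineVec (L : Type) (dW' c.D 1)) (fun _ => dW'_real c.D 1) ι₁ (HypCensus.cmPlace (L : Type) ι₁)) ≃ Unit)
  (eS : NegIdx (cmXW (L : Type) (frameD V) (lineVec (L : Type) (dW' c.D 1)) (fun _ => dW'_real c.D 1) ι₁ (HypCensus.cmPlace (L : Type) ι₁)) ≃ Empty)
  (hχ : ∀ u : stabilizer U21 x₀,
    ((lineScalar_three V c.D hGR hGR₂ hGR₃ η₃ (u : U21) : ℂˣ) : ℂ) *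
        ((matA (stabilizerEquivK21.symm u)).det ^ (lineVacExponentsThree V c hGR₃ eR eS).eP *
          sclD (stabilizerEquivK21.symm u) ^ (lineVacExponentsThree V c hGR₃ eR eS).eQ) =
      star (sclD (stabilizerEquivK21.symm u)))
  (a : {v : InfinitePlace ↥(maximalRealSubfield L) // v.IsReal} → ℤ)
  (hω : ∀ b : {v : InfinitePlace ↥(maximalRealSubfield L) // v.IsReal}, b ≠ HypCensus.cmPlace (L : Type) ι₁ →
    ∀ (u : UnitaryGroup.archLocal (L : Type) 3 (Matrix.diagonal (frameD V)) (cmPlaceOver (L : Type) b)) (ℓ : Module.Dual ℂ (Fin 2 → ℂ)),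
      cmArchWeilRep (L : Type) e₁ (frameD V) (frameD_real V) (frameD_ne V) (lineVec (L : Type) (dW' c.D 1)) (fun _ => dW'_real c.D 1)
          (fun _ => dW'_ne c.D 1) hGR₃
          (UnitaryGroup.archSingle (↥(maximalRealSubfield L)) L (IsCMField.complexConj L) 3 (Matrix.diagonal (frameD V))
            (IsCMField.complexConj_ne_one L) (NumberField.complexConj_smul_infinitePlace (L : Type)) (cmPlaceOver (L : Type) b) u, 1)
          (blockFamilyOfAt (L : Type) e₁ (frameD V) (frameD_real V) (frameD_ne V) (lineVec (L : Type) (dW' c.D 1)) (fun _ => dW'_real c.D 1)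
            (fun _ => dW'_ne c.D 1) ι₁ (blockPosEquiv V) (blockNegEquiv V) eR eS (degOnePDual Empty) (binvPi 1) ℓ) =
        (((u : UnitaryGroup.archLocal (L : Type) 3 (Matrix.diagonal (frameD V)) (cmPlaceOver (L : Type) b)) : GL (Fin 3) ℂ) :
            Matrix (Fin 3) (Fin 3) ℂ).det ^ a b •
          blockFamilyOfAt (L : Type) e₁ (frameD V) (frameD_real V) (frameD_ne V) (lineVec (L : Type) (dW' c.D 1)) (fun _ => dW'_real c.D 1)
            (fun _ => dW'_ne c.D 1) ι₁ (blockPosEquiv V) (blockNegEquiv V) eR eS (degOnePDual Empty) (binvPi 1) ℓ)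
  (hdef : ∀ b : {v : InfinitePlace ↥(maximalRealSubfield L) // v.IsReal}, b ≠ HypCensus.cmPlace (L : Type) ι₁ →
    ∀ u : UnitaryGroup.archLocal (L : Type) 3 (Matrix.diagonal (frameD V)) (cmPlaceOver (L : Type) b),
      ((archScalar_threeG V c.D hGR hGR₂ hGR₃ η₃
          (UnitaryGroup.archSingle (↥(maximalRealSubfield L)) L (IsCMField.complexConj L) 3 (Matrix.diagonal (frameD V))
            (IsCMField.complexConj_ne_one L) (NumberField.complexConj_smul_infinitePlace (L : Type)) (cmPlaceOver (L : Type) b) u) : ℂˣ) : ℂ) *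
        (((u : UnitaryGroup.archLocal (L : Type) 3 (Matrix.diagonal (frameD V)) (cmPlaceOver (L : Type) b)) : GL (Fin 3) ℂ) :
            Matrix (Fin 3) (Fin 3) ℂ).det ^ a b = 1)

include hω hdef in
/-- the AWAY factor of the centre fixes every member of the line-3 slot family under `c₃ • ω_∞,3` ((c5), #CA20's place induction). -/
theorem archScalar_threeG_smul_centerAway_blockFamilyOfAt
    (t : ↥(Literature.NumberTheory.Automorphic.relNormOneInfUnits (↥(maximalRealSubfield L)) L)) (ℓ : Module.Dual ℂ (Fin 2 → ℂ)) :
    ((archScalar_threeG V c.D hGR hGR₂ hGR₃ η₃ (centerAway V t) : ℂˣ) : ℂ) •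
        cmArchWeilRep (L : Type) e₁ (frameD V) (frameD_real V) (frameD_ne V) (lineVec (L : Type) (dW' c.D 1)) (fun _ => dW'_real c.D 1)
          (fun _ => dW'_ne c.D 1) hGR₃ (centerAway V t, 1)
          (blockFamilyOfAt (L : Type) e₁ (frameD V) (frameD_real V) (frameD_ne V) (lineVec (L : Type) (dW' c.D 1)) (fun _ => dW'_real c.D 1)
            (fun _ => dW'_ne c.D 1) ι₁ (blockPosEquiv V) (blockNegEquiv V) eR eS (degOnePDual Empty) (binvPi 1) ℓ) =
      blockFamilyOfAt (L : Type) e₁ (frameD V) (frameD_real V) (frameD_ne V) (lineVec (L : Type) (dW' c.D 1)) (fun _ => dW'_real c.D 1)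
        (fun _ => dW'_ne c.D 1) ι₁ (blockPosEquiv V) (blockNegEquiv V) eR eS (degOnePDual Empty) (binvPi 1) ℓ := by
  have h := smul_apply_eq_self_of_places (L : Type) (Matrix.diagonal (frameD V))
    ((cmArchWeilRep (L : Type) e₁ (frameD V) (frameD_real V) (frameD_ne V) (lineVec (L : Type) (dW' c.D 1)) (fun _ => dW'_real c.D 1)
      (fun _ => dW'_ne c.D 1) hGR₃).comp (MonoidHom.inl _ _))
    (archScalar_threeG V c.D hGR hGR₂ hGR₃ η₃)
    (blockFamilyOfAt (L : Type) e₁ (frameD V) (frameD_real V) (frameD_ne V) (lineVec (L : Type) (dW' c.D 1)) (fun _ => dW'_real c.D 1)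
      (fun _ => dW'_ne c.D 1) ι₁ (blockPosEquiv V) (blockNegEquiv V) eR eS (degOnePDual Empty) (binvPi 1) ℓ)
    (UnitaryGroup.cmPlace (L : Type) ι₁) (fun b hb u => by
      rw [MonoidHom.comp_apply, MonoidHom.inl_apply, hω b (ne_cmPlace_of_cmPlaceOver_ne hb) u ℓ, smul_smul,
        hdef b (ne_cmPlace_of_cmPlaceOver_ne hb) u, one_smul])
    (centerAway V t) (archAt_centerAway V t)
  rw [MonoidHom.comp_apply, MonoidHom.inl_apply] at h
  exact h

include hemb hχ in
/-- the `ι₁`-SECTION factor of the centre fixes every member of the line-3 slot family under `c₃ • ω_∞,3` (`harm` at the CENTRAL element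
`z_t · 1 ∈ K`, `τ₁^∨(z · 1) = id`). -/
theorem lineScalar_three_smul_centerK_blockFamilyOfAt
    (t : ↥(Literature.NumberTheory.Automorphic.relNormOneInfUnits (↥(maximalRealSubfield L)) L)) (ℓ : Module.Dual ℂ (Fin 2 → ℂ)) :
    ((lineScalar_three V c.D hGR hGR₂ hGR₃ η₃ ((centerK (L : Type) ι₁ t : stabilizer U21 x₀) : U21) : ℂˣ) : ℂ) •
        cmArchWeilRep (L : Type) e₁ (frameD V) (frameD_real V) (frameD_ne V) (lineVec (L : Type) (dW' c.D 1)) (fun _ => dW'_real c.D 1)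
          (fun _ => dW'_ne c.D 1) hGR₃ (archSectionFrameOf V ((centerK (L : Type) ι₁ t : stabilizer U21 x₀) : U21), 1)
          (blockFamilyOfAt (L : Type) e₁ (frameD V) (frameD_real V) (frameD_ne V) (lineVec (L : Type) (dW' c.D 1)) (fun _ => dW'_real c.D 1)
            (fun _ => dW'_ne c.D 1) ι₁ (blockPosEquiv V) (blockNegEquiv V) eR eS (degOnePDual Empty) (binvPi 1) ℓ) =
      blockFamilyOfAt (L : Type) e₁ (frameD V) (frameD_real V) (frameD_ne V) (lineVec (L : Type) (dW' c.D 1)) (fun _ => dW'_real c.D 1)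
        (fun _ => dW'_ne c.D 1) ι₁ (blockPosEquiv V) (blockNegEquiv V) eR eS (degOnePDual Empty) (binvPi 1) ℓ := by
  have hv := harm_lineOmega_threeG V c hGR hGR₂ hGR₃ η₃ (binvPi 1) hemb eR eS hχ (centerK (L : Type) ι₁ t) ℓ
  rw [centerK_def, weightOf_dual_blockK_centralK, ← centerK_def, lineOmega_three, Representation.smulPull_apply] at hv
  exact hv

include hemb hχ hω hdef in
/-- **(CF₃) on the slot family**: the archimedean CENTRE `t · 1_V` in the `U(V)`-slot of line 3 fixes every member `Φ_∞,3(ℓ)`: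
`lineCharV_3(u_t · 1_V) • ω_∞,3(t · 1₃, 1) Φ_∞,3(ℓ) = Φ_∞,3(ℓ)`. -/
theorem lineCharV_three_smul_cmArchCenter_blockFamilyOfAt
    (t : ↥(Literature.NumberTheory.Automorphic.relNormOneInfUnits (↥(maximalRealSubfield L)) L)) (ℓ : Module.Dual ℂ (Fin 2 → ℂ)) :
    ((lineCharV_three V c.D hGR hGR₂ hGR₃ η₃ (CMCenter (L : Type) (frameD V) ((UnitaryGroup.cmAdelicOneEquivRelNormOne (L : Type)).symm
        (Literature.NumberTheory.Automorphic.relNormOneInfToIdeles (↥(maximalRealSubfield L)) L t))) : ℂˣ) : ℂ) •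
        cmArchWeilRep (L : Type) e₁ (frameD V) (frameD_real V) (frameD_ne V) (lineVec (L : Type) (dW' c.D 1)) (fun _ => dW'_real c.D 1)
          (fun _ => dW'_ne c.D 1) hGR₃ (cmArchCenter (L : Type) 3 (Matrix.diagonal (frameD V)) t, 1)
          (blockFamilyOfAt (L : Type) e₁ (frameD V) (frameD_real V) (frameD_ne V) (lineVec (L : Type) (dW' c.D 1)) (fun _ => dW'_real c.D 1)
            (fun _ => dW'_ne c.D 1) ι₁ (blockPosEquiv V) (blockNegEquiv V) eR eS (degOnePDual Empty) (binvPi 1) ℓ) =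
      blockFamilyOfAt (L : Type) e₁ (frameD V) (frameD_real V) (frameD_ne V) (lineVec (L : Type) (dW' c.D 1)) (fun _ => dW'_real c.D 1)
        (fun _ => dW'_ne c.D 1) ι₁ (blockPosEquiv V) (blockNegEquiv V) eR eS (degOnePDual Empty) (binvPi 1) ℓ := by
  rw [← archToAdelic_cmArchCenter_frameD, ← archScalar_threeG_eq_lineCharV, cmArchCenter_eq_archSectionFrameOf_mul_centerAway V t,
    map_mul, Units.val_mul,
    show ((archSectionFrameOf V ((centerK (L : Type) ι₁ t : stabilizer U21 x₀) : U21) * centerAway V t,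
        (1 : UnitaryGroup.arch (↥(maximalRealSubfield L)) L (IsCMField.complexConj L) 1 (Matrix.diagonal (lineVec (L : Type) (dW' c.D 1))))) :
        UnitaryGroup.arch (↥(maximalRealSubfield L)) L (IsCMField.complexConj L) 3 (Matrix.diagonal (frameD V)) ×
          UnitaryGroup.arch (↥(maximalRealSubfield L)) L (IsCMField.complexConj L) 1 (Matrix.diagonal (lineVec (L : Type) (dW' c.D 1)))) =
      (archSectionFrameOf V ((centerK (L : Type) ι₁ t : stabilizer U21 x₀) : U21), 1) * (centerAway V t, 1) by rw [Prod.mk_mul_mk, mul_one],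
    map_mul, Module.End.mul_apply, mul_smul, ← map_smul, archScalar_threeG_smul_centerAway_blockFamilyOfAt V c hGR hGR₂ hGR₃ η₃ eR eS a hω hdef]
  exact lineScalar_three_smul_centerK_blockFamilyOfAt V c hGR hGR₂ hGR₃ η₃ hemb eR eS hχ t ℓ

include hemb hχ hω hdef in
/-- **(CF₃) on thin-coset test functions**: `lineCharV_3(u_t·1_V) • ω₃(u_t·1_V, 1) φ_N(Φ_∞,3(ℓ)) = φ_N(Φ_∞,3(ℓ))` at every base point and level
(the hypothesis `hfix` of `w_mul_lineCharV_three_eq_torusScalar`, DISCHARGED for the harmonic family). -/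
theorem lineCharV_three_smul_cmPairRep_center_testFun
    (t : ↥(Literature.NumberTheory.Automorphic.relNormOneInfUnits (↥(maximalRealSubfield L)) L)) (ℓ : Module.Dual ℂ (Fin 2 → ℂ))
    (x : Fin 3 → ↥(maximalRealSubfield L)) (N : ℕ) :
    ((lineCharV_three V c.D hGR hGR₂ hGR₃ η₃ (CMCenter (L : Type) (frameD V) ((UnitaryGroup.cmAdelicOneEquivRelNormOne (L : Type)).symm
        (Literature.NumberTheory.Automorphic.relNormOneInfToIdeles (↥(maximalRealSubfield L)) L t))) : ℂˣ) : ℂ) •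
        cmPairRep (L : Type) e₁ (frameD V) (frameD_real V) (frameD_ne V) (lineVec (L : Type) (dW' c.D 1)) (fun _ => dW'_real c.D 1)
          (fun _ => dW'_ne c.D 1) hGR₃
          (CMCenter (L : Type) (frameD V) ((UnitaryGroup.cmAdelicOneEquivRelNormOne (L : Type)).symm
            (Literature.NumberTheory.Automorphic.relNormOneInfToIdeles (↥(maximalRealSubfield L)) L t)), 1)
          (SupplyInstance.testFun (↥(maximalRealSubfield L)) (Fin 3)
            (blockFamilyOfAt (L : Type) e₁ (frameD V) (frameD_real V) (frameD_ne V) (lineVec (L : Type) (dW' c.D 1)) (fun _ => dW'_real c.D 1)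
              (fun _ => dW'_ne c.D 1) ι₁ (blockPosEquiv V) (blockNegEquiv V) eR eS (degOnePDual Empty) (binvPi 1) ℓ) x N) =
      SupplyInstance.testFun (↥(maximalRealSubfield L)) (Fin 3)
        (blockFamilyOfAt (L : Type) e₁ (frameD V) (frameD_real V) (frameD_ne V) (lineVec (L : Type) (dW' c.D 1)) (fun _ => dW'_real c.D 1)
          (fun _ => dW'_ne c.D 1) ι₁ (blockPosEquiv V) (blockNegEquiv V) eR eS (degOnePDual Empty) (binvPi 1) ℓ) x N := by
  rw [cmPairRep_cmCenter_inf_one_testFun, ← testFun_smul,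
    lineCharV_three_smul_cmArchCenter_blockFamilyOfAt V c hGR hGR₂ hGR₃ η₃ hemb eR eS hχ a hω hdef]

include hemb hχ hω hdef in
/-- **(Hw₃′) DISCHARGED for an archimedean input pinned on the harmonic family**: for ANY four `η`'s, ANY conjugated-plane splittings and
ANY `A : ArchLineInput V (lineRepOf … 3)` with `A.Φinf = Φ_∞,3(ℓ₀)`:  `A.w t · lineCharV_3 (u_t · 1_V) = torusScalar_3 (u_t)` for every `t`.
At the pin of record `η₃ := etaT₃ V c.D η ν'`. -/
theorem w_mul_lineCharV_three_eq_torusScalar_of_eq_blockFamilyOfAt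
    (hGR₀ : (cmSplittingDatum (L : Type) (e₁) (frameD V) (frameD_real V) (frameD_ne V) (lineVec (L : Type) (dW c.D 0))
      (fun _ => dW_real c.D 0) (fun _ => dW_ne c.D 0)).CompatibleSplitting)
    (hGR₁ : (cmSplittingDatum (L : Type) (e₁) (frameD V) (frameD_real V) (frameD_ne V) (lineVec (L : Type) (dW c.D 1))
      (fun _ => dW_real c.D 1) (fun _ => dW_ne c.D 1)).CompatibleSplitting)
    (η₀ η₁ : CMAdelic (L : Type) (frameD V) × CMAdelicOne (L : Type) →* ℂˣ)
    (A : ArchLineInput V (lineRepOf V c.D hGR hGR₀ hGR₁ hGR₂ hGR₃ η₀ η₁ η₂ η₃ 3)) {ℓ₀ : Module.Dual ℂ (Fin 2 → ℂ)}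
    (hΦ : A.Φinf = blockFamilyOfAt (L : Type) e₁ (frameD V) (frameD_real V) (frameD_ne V) (lineVec (L : Type) (dW' c.D 1)) (fun _ => dW'_real c.D 1)
      (fun _ => dW'_ne c.D 1) ι₁ (blockPosEquiv V) (blockNegEquiv V) eR eS (degOnePDual Empty) (binvPi 1) ℓ₀)
    (t : ↥(Literature.NumberTheory.Automorphic.relNormOneInfUnits (↥(maximalRealSubfield L)) L)) :
    A.w t * ((lineCharV_three V c.D hGR hGR₂ hGR₃ η₃ (CMCenter (L : Type) (frameD V)
          ((UnitaryGroup.cmAdelicOneEquivRelNormOne (L : Type)).symm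
            (Literature.NumberTheory.Automorphic.relNormOneInfToIdeles (↥(maximalRealSubfield L)) L t))) : ℂˣ) : ℂ) =
      ((torusScalar_threeG V c.D hGR hGR₂ hGR₃ η₃ ((UnitaryGroup.cmAdelicOneEquivRelNormOne (L : Type)).symm
            (Literature.NumberTheory.Automorphic.relNormOneInfToIdeles (↥(maximalRealSubfield L)) L t)) : ℂˣ) : ℂ) :=
  by
  have hfix := lineCharV_three_smul_cmPairRep_center_testFun V c hGR hGR₂ hGR₃ η₃ hemb eR eS hχ a hω hdef t ℓ₀ A.x₀ 1
  rw [← hΦ] at hfix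
  exact w_mul_lineCharV_three_eq_torusScalar V c.D hGR hGR₀ hGR₁ hGR₂ hGR₃ η₀ η₁ η₂ η₃ A t one_ne_zero hfix


-- port_pkg: scope closed for this part
end Three
end Honest34
end HodgeCM.Model.ArchSideTerm
end
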